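import Summits.ValiantsHypothesis.ValiantsHypothesis.Theorems.KPlusLogSqLawTropicalBToeplitzFramedSplit

/-!
# Route `KPlusLogSqLaw`, crux `TropicalB` — Toeplitz sector: the first rows of the FRAMED count, `Φ^fr_Toep(3) = 2`, `Φ^fr_Toep(4) = 4`, `8 ≤ Φ^fr_Toep(5) ≤ 9`

HONEST FRAMING.  Helper toward the registered stubs `stub_tropThin` / `stub_tropFat` of
`Cruxes/TropicalB/Lines/birth.lean` (crux `Summit.ValiantsHypothesis.ValiantsHypothesis.Theses.KPlusLogSqLaw.TropicalB`,
ledger item `stmt-ValiantsHypothesis-19771`, route `KPlusLogSqLaw`; cell `pub-symmetroid`, seat `val-sym-trop-p3`,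
2026-08-26).  KERNEL ROWS of the framed sub-count `Toeplitz.FramedInstanceBound m Φ` («`Φ^fr_Toep(m) ≤ Φ`», `…ToeplitzFramedSplit`),
the bookkeeping half of `T ≤ T⁰ + T^framed`.  With `…ToeplitzFrameless` (`Φ⁰_Toep(3..5) = 2, 5, 10`) and `…ToeplitzSmallSizes` /
`…ToeplitzFiveHub` (`Φ_Toep(3) = 4`, `Φ_Toep(4) = 8`, `13 ≤ Φ_Toep(5) ≤ 16`) the split is EXACT at `m = 3` (`2 + 2 = 4`) and LOSSY from
`m = 4` on (`5 + 4 = 9 > 8`; `10 + 8 = 18 > 16`): frameless and framed members TRADE OFF along one line.  Conjecture T / T⁰ /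
T^framed are OPEN; nothing here bears on `TropicalB` for general designs, `KPlusLogSqLaw`, `MatrixDescartes` or `VP ≠ VNP`.

THE RESULTS. `framedInstanceBound_three_iff` (`Φ^fr_Toep(3) = 2`), `framedInstanceBound_four_iff` (`Φ^fr_Toep(4) = 4`: all four framed
unshared-profile permutations in ONE chain, instance `ψ = (25,15,24,7,20,7,2)`), `framedInstanceBound_five : FramedInstanceBound 5 9`
(ten framed unshared-profile permutations, one additive quadruple among them) and `framed_five_chain_8` /
`not_framedInstanceBound_five_7` (a chain with `8` framed members, instance `ψ = (40,18,14,39,14,34,29,3,32)`; located by a hill climb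
maximising framed members).  Upper sides by `decide` (`decide +kernel` at `m = 5`), lower sides by `decide` over all permutations.

References: folklore; `…ToeplitzFramedSplit`, `…ToeplitzFrameless`, `…ToeplitzSmallSizes` (this seat).
-/

set_option linter.dupNamespace false
set_option autoImplicit false

namespace Summit.ValiantsHypothesis.ValiantsHypothesis.Theorems.KPlusLogSqLaw.Toeplitz

open scoped BigOperators
open Finset

/-! ## `m = 3`: `Φ^fr_Toep(3) = 2` -/

section Three

/-- `2` permutations of `Fin 3` are framed (not frameless) with an unshared profile (`decide`). -/
theorem card_framedUnshared_three :
    ((univ.filter fun σ : Equiv.Perm (Fin 3) => ∀ σ' : Equiv.Perm (Fin 3),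
      (univ.val.map fun b : Fin 3 => (σ' b : ℤ) - b) = (univ.val.map fun b : Fin 3 => (σ b : ℤ) - b) → σ' = σ).filter fun σ : Equiv.Perm (Fin 3) =>
      ¬ (∀ a ∈ range 3, ∀ ℓ ∈ range 3, 1 ≤ ℓ → a + ℓ ≤ 3 →
        ∃ b : Fin 3, a ≤ (b : ℕ) ∧ (b : ℕ) < a + ℓ ∧ ¬ (a ≤ (σ b : ℕ) ∧ (σ b : ℕ) < a + ℓ))).card = 2 := by
  decide

/-- members of an all-framed chain are framed with unshared profiles. -/
theorem image_subset_framedUnshared_three (ψ α : ℤ → ℤ) (P : ℤ → Prop) {N : ℕ} (θ' : Fin (N + 1) → ℤ)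
    (τ : Fin (N + 1) → Equiv.Perm (Fin 3)) (hfr : ∀ k, ¬ Frameless (τ k)) (hτP : ∀ k b, P ((τ k b : ℤ) - b))
    (huniq : ∀ k (σ : Equiv.Perm (Fin 3)), σ ≠ τ k → (∀ b, P ((σ b : ℤ) - b)) →
      ∑ b, (θ' k * ψ ((σ b : ℤ) - b) + α ((σ b : ℤ) - b)) <
        ∑ b, (θ' k * ψ ((τ k b : ℤ) - b) + α ((τ k b : ℤ) - b))) :
    univ.image τ ⊆ ((univ.filter fun σ : Equiv.Perm (Fin 3) => ∀ σ' : Equiv.Perm (Fin 3),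
      (univ.val.map fun b : Fin 3 => (σ' b : ℤ) - b) = (univ.val.map fun b : Fin 3 => (σ b : ℤ) - b) → σ' = σ).filter fun σ : Equiv.Perm (Fin 3) =>
      ¬ (∀ a ∈ range 3, ∀ ℓ ∈ range 3, 1 ≤ ℓ → a + ℓ ≤ 3 →
        ∃ b : Fin 3, a ≤ (b : ℕ) ∧ (b : ℕ) < a + ℓ ∧ ¬ (a ≤ (σ b : ℕ) ∧ (σ b : ℕ) < a + ℓ))) := by
  intro σ hσ
  obtain ⟨k, -, rfl⟩ := mem_image.mp hσ
  rw [mem_filter]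
  exact ⟨image_subset_unshared ψ α P θ' τ hτP huniq hσ, fun h => hfr k ((frameless_iff_range (τ k)).mpr h)⟩

/-- **`Φ^fr_Toep(3) ≤ 2`.** -/
theorem framedInstanceBound_three : FramedInstanceBound 3 2 := by
  intro ψ α P N θ' τ hθ hinj hfr hτP huniq
  have hcard : (univ.image τ).card = N + 1 := by
    rw [card_image_of_injective _ hinj, card_univ, Fintype.card_fin]
  have h := card_le_card (image_subset_framedUnshared_three ψ α P θ' τ hfr hτP huniq)
  rw [hcard, card_framedUnshared_three] at h
  exact h

/-- **`Φ^fr_Toep(3) ≥ 2`: an explicit all-framed chain with `2` members.** [folklore] -/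
theorem framed_three_chain_2 :
    ∃ (ψ α : ℤ → ℤ) (θ' : Fin 2 → ℤ) (τ : Fin 2 → Equiv.Perm (Fin 3)),
      StrictMono θ' ∧ Function.Injective τ ∧ (∀ k, ¬ Frameless (τ k)) ∧
      ∀ k (σ : Equiv.Perm (Fin 3)), σ ≠ τ k →
        ∑ b, (θ' k * ψ ((σ b : ℤ) - b) + α ((σ b : ℤ) - b)) <
          ∑ b, (θ' k * ψ ((τ k b : ℤ) - b) + α ((τ k b : ℤ) - b)) := by
  -- instance: ψ = [0, 0, 1, 0, 1] , α = [0, 0, -2, 2, 4] on δ = -2..2; framed members ['210', '012'] at θ = [3, 11]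
  let ψᵢ : ℤ → ℤ := fun δ : ℤ => if δ = -2 then 0 else if δ = -1 then 0 else if δ = 0 then 1 else if δ = 1 then 0 else if δ = 2 then 1 else 0
  let αᵢ : ℤ → ℤ := fun δ : ℤ => if δ = -2 then 0 else if δ = -1 then 0 else if δ = 0 then -2 else if δ = 1 then 2 else if δ = 2 then 4 else 0
  let τ0 : Equiv.Perm (Fin 3) := (⟨![2, 1, 0], ![2, 1, 0], by decide, by decide⟩ : Equiv.Perm (Fin 3))
  let τ1 : Equiv.Perm (Fin 3) := (⟨![0, 1, 2], ![0, 1, 2], by decide, by decide⟩ : Equiv.Perm (Fin 3))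
  let θs : Fin 2 → ℤ := ![3, 11]
  let τs : Fin 2 → Equiv.Perm (Fin 3) := ![τ0, τ1]
  have h0 : ∀ σ : Equiv.Perm (Fin 3), σ ≠ τ0 →
      ∑ b, ((3 : ℤ) * ψᵢ ((σ b : ℤ) - b) + αᵢ ((σ b : ℤ) - b)) < ∑ b, ((3 : ℤ) * ψᵢ ((τ0 b : ℤ) - b) + αᵢ ((τ0 b : ℤ) - b)) := by
    decide
  have h1 : ∀ σ : Equiv.Perm (Fin 3), σ ≠ τ1 →
      ∑ b, ((11 : ℤ) * ψᵢ ((σ b : ℤ) - b) + αᵢ ((σ b : ℤ) - b)) < ∑ b, ((11 : ℤ) * ψᵢ ((τ1 b : ℤ) - b) + αᵢ ((τ1 b : ℤ) - b)) := by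
    decide
  refine ⟨ψᵢ, αᵢ, θs, τs, Fin.strictMono_iff_lt_succ.mpr (by decide), by decide, fun k => ?_, fun k => ?_⟩
  · fin_cases k <;> exact fun hf => absurd ((frameless_iff_range _).mp hf) (by decide)
  · fin_cases k
    · exact h0
    · exact h1

/-- `Φ^fr_Toep(3) > 1`. -/
theorem not_framedInstanceBound_three_1 : ¬ FramedInstanceBound 3 1 := by
  intro h
  obtain ⟨ψ, α, θ', τ, hθ, hτ, hfr, hu⟩ := framed_three_chain_2
  have := h ψ α (fun _ => True) 1 θ' τ hθ hτ hfr (fun _ _ => trivial) (fun k σ hσ _ => hu k σ hσ)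
  omega

/-- **EXACT ROW `Φ^fr_Toep(3) = 2`** (with `Φ⁰_Toep(3) = 2`, `Φ_Toep(3) = 4`: here the split `T ≤ T⁰ + T^framed` is exact). -/
theorem framedInstanceBound_three_iff (Φ : ℕ) : FramedInstanceBound 3 Φ ↔ 2 ≤ Φ :=
  ⟨fun h => by
    by_contra hh
    exact not_framedInstanceBound_three_1 (fun ψ α P N θ' τ a b c d e => (h ψ α P N θ' τ a b c d e).trans (by omega)),
   fun h ψ α P N θ' τ a b c d e => (framedInstanceBound_three ψ α P N θ' τ a b c d e).trans h⟩

end Three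

/-! ## `m = 4`: `Φ^fr_Toep(4) = 4` -/

section Four

/-- `4` permutations of `Fin 4` are framed (not frameless) with an unshared profile (`decide`). -/
theorem card_framedUnshared_four :
    ((univ.filter fun σ : Equiv.Perm (Fin 4) => ∀ σ' : Equiv.Perm (Fin 4),
      (univ.val.map fun b : Fin 4 => (σ' b : ℤ) - b) = (univ.val.map fun b : Fin 4 => (σ b : ℤ) - b) → σ' = σ).filter fun σ : Equiv.Perm (Fin 4) =>
      ¬ (∀ a ∈ range 4, ∀ ℓ ∈ range 4, 1 ≤ ℓ → a + ℓ ≤ 4 →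
        ∃ b : Fin 4, a ≤ (b : ℕ) ∧ (b : ℕ) < a + ℓ ∧ ¬ (a ≤ (σ b : ℕ) ∧ (σ b : ℕ) < a + ℓ))).card = 4 := by
  decide

/-- members of an all-framed chain are framed with unshared profiles. -/
theorem image_subset_framedUnshared_four (ψ α : ℤ → ℤ) (P : ℤ → Prop) {N : ℕ} (θ' : Fin (N + 1) → ℤ)
    (τ : Fin (N + 1) → Equiv.Perm (Fin 4)) (hfr : ∀ k, ¬ Frameless (τ k)) (hτP : ∀ k b, P ((τ k b : ℤ) - b))
    (huniq : ∀ k (σ : Equiv.Perm (Fin 4)), σ ≠ τ k → (∀ b, P ((σ b : ℤ) - b)) →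
      ∑ b, (θ' k * ψ ((σ b : ℤ) - b) + α ((σ b : ℤ) - b)) <
        ∑ b, (θ' k * ψ ((τ k b : ℤ) - b) + α ((τ k b : ℤ) - b))) :
    univ.image τ ⊆ ((univ.filter fun σ : Equiv.Perm (Fin 4) => ∀ σ' : Equiv.Perm (Fin 4),
      (univ.val.map fun b : Fin 4 => (σ' b : ℤ) - b) = (univ.val.map fun b : Fin 4 => (σ b : ℤ) - b) → σ' = σ).filter fun σ : Equiv.Perm (Fin 4) =>
      ¬ (∀ a ∈ range 4, ∀ ℓ ∈ range 4, 1 ≤ ℓ → a + ℓ ≤ 4 →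
        ∃ b : Fin 4, a ≤ (b : ℕ) ∧ (b : ℕ) < a + ℓ ∧ ¬ (a ≤ (σ b : ℕ) ∧ (σ b : ℕ) < a + ℓ))) := by
  intro σ hσ
  obtain ⟨k, -, rfl⟩ := mem_image.mp hσ
  rw [mem_filter]
  exact ⟨image_subset_unshared ψ α P θ' τ hτP huniq hσ, fun h => hfr k ((frameless_iff_range (τ k)).mpr h)⟩

/-- **`Φ^fr_Toep(4) ≤ 4`.** -/
theorem framedInstanceBound_four : FramedInstanceBound 4 4 := by
  intro ψ α P N θ' τ hθ hinj hfr hτP huniq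
  have hcard : (univ.image τ).card = N + 1 := by
    rw [card_image_of_injective _ hinj, card_univ, Fintype.card_fin]
  have h := card_le_card (image_subset_framedUnshared_four ψ α P θ' τ hfr hτP huniq)
  rw [hcard, card_framedUnshared_four] at h
  exact h

/-- **`Φ^fr_Toep(4) ≥ 4`: an explicit all-framed chain with `4` members.** [folklore] -/
theorem framed_four_chain_4 :
    ∃ (ψ α : ℤ → ℤ) (θ' : Fin 4 → ℤ) (τ : Fin 4 → Equiv.Perm (Fin 4)),
      StrictMono θ' ∧ Function.Injective τ ∧ (∀ k, ¬ Frameless (τ k)) ∧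
      ∀ k (σ : Equiv.Perm (Fin 4)), σ ≠ τ k →
        ∑ b, (θ' k * ψ ((σ b : ℤ) - b) + α ((σ b : ℤ) - b)) <
          ∑ b, (θ' k * ψ ((τ k b : ℤ) - b) + α ((τ k b : ℤ) - b)) := by
  -- instance: ψ = [25, 15, 24, 7, 20, 7, 2] , α = [3001, 751, -1236, -2158, 99, 1457, 3293] on δ = -3..3; framed members ['0123', '3120', '3210', '1032'] at θ = [-819, -816, -13, 1860]
  let ψᵢ : ℤ → ℤ := fun δ : ℤ => if δ = -3 then 25 else if δ = -2 then 15 else if δ = -1 then 24 else if δ = 0 then 7 else if δ = 1 then 20 else if δ = 2 then 7 else if δ = 3 then 2 else 0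
  let αᵢ : ℤ → ℤ := fun δ : ℤ => if δ = -3 then 3001 else if δ = -2 then 751 else if δ = -1 then -1236 else if δ = 0 then -2158 else if δ = 1 then 99 else if δ = 2 then 1457 else if δ = 3 then 3293 else 0
  let τ0 : Equiv.Perm (Fin 4) := (⟨![0, 1, 2, 3], ![0, 1, 2, 3], by decide, by decide⟩ : Equiv.Perm (Fin 4))
  let τ1 : Equiv.Perm (Fin 4) := (⟨![3, 1, 2, 0], ![3, 1, 2, 0], by decide, by decide⟩ : Equiv.Perm (Fin 4))
  let τ2 : Equiv.Perm (Fin 4) := (⟨![3, 2, 1, 0], ![3, 2, 1, 0], by decide, by decide⟩ : Equiv.Perm (Fin 4))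
  let τ3 : Equiv.Perm (Fin 4) := (⟨![1, 0, 3, 2], ![1, 0, 3, 2], by decide, by decide⟩ : Equiv.Perm (Fin 4))
  let θs : Fin 4 → ℤ := ![-819, -816, -13, 1860]
  let τs : Fin 4 → Equiv.Perm (Fin 4) := ![τ0, τ1, τ2, τ3]
  have h0 : ∀ σ : Equiv.Perm (Fin 4), σ ≠ τ0 →
      ∑ b, ((-819 : ℤ) * ψᵢ ((σ b : ℤ) - b) + αᵢ ((σ b : ℤ) - b)) < ∑ b, ((-819 : ℤ) * ψᵢ ((τ0 b : ℤ) - b) + αᵢ ((τ0 b : ℤ) - b)) := by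
    decide
  have h1 : ∀ σ : Equiv.Perm (Fin 4), σ ≠ τ1 →
      ∑ b, ((-816 : ℤ) * ψᵢ ((σ b : ℤ) - b) + αᵢ ((σ b : ℤ) - b)) < ∑ b, ((-816 : ℤ) * ψᵢ ((τ1 b : ℤ) - b) + αᵢ ((τ1 b : ℤ) - b)) := by
    decide
  have h2 : ∀ σ : Equiv.Perm (Fin 4), σ ≠ τ2 →
      ∑ b, ((-13 : ℤ) * ψᵢ ((σ b : ℤ) - b) + αᵢ ((σ b : ℤ) - b)) < ∑ b, ((-13 : ℤ) * ψᵢ ((τ2 b : ℤ) - b) + αᵢ ((τ2 b : ℤ) - b)) := by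
    decide
  have h3 : ∀ σ : Equiv.Perm (Fin 4), σ ≠ τ3 →
      ∑ b, ((1860 : ℤ) * ψᵢ ((σ b : ℤ) - b) + αᵢ ((σ b : ℤ) - b)) < ∑ b, ((1860 : ℤ) * ψᵢ ((τ3 b : ℤ) - b) + αᵢ ((τ3 b : ℤ) - b)) := by
    decide
  refine ⟨ψᵢ, αᵢ, θs, τs, Fin.strictMono_iff_lt_succ.mpr (by decide), by decide, fun k => ?_, fun k => ?_⟩
  · fin_cases k <;> exact fun hf => absurd ((frameless_iff_range _).mp hf) (by decide)
  · fin_cases k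
    · exact h0
    · exact h1
    · exact h2
    · exact h3

/-- `Φ^fr_Toep(4) > 3`. -/
theorem not_framedInstanceBound_four_3 : ¬ FramedInstanceBound 4 3 := by
  intro h
  obtain ⟨ψ, α, θ', τ, hθ, hτ, hfr, hu⟩ := framed_four_chain_4
  have := h ψ α (fun _ => True) 3 θ' τ hθ hτ hfr (fun _ _ => trivial) (fun k σ hσ _ => hu k σ hσ)
  omega

/-- **EXACT ROW `Φ^fr_Toep(4) = 4`** (all four framed unshared-profile permutations `0123, 1032, 3210, 3120` in one chain; with
`Φ⁰_Toep(4) = 5` the split gives `9 > Φ_Toep(4) = 8`: lossy from `m = 4` on). -/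
theorem framedInstanceBound_four_iff (Φ : ℕ) : FramedInstanceBound 4 Φ ↔ 4 ≤ Φ :=
  ⟨fun h => by
    by_contra hh
    exact not_framedInstanceBound_four_3 (fun ψ α P N θ' τ a b c d e => (h ψ α P N θ' τ a b c d e).trans (by omega)),
   fun h ψ α P N θ' τ a b c d e => (framedInstanceBound_four ψ α P N θ' τ a b c d e).trans h⟩

end Four

/-! ## `m = 5`: `8 ≤ Φ^fr_Toep(5) ≤ 9` -/

section Five

/-- `10` permutations of `Fin 5` are framed (not frameless) with an unshared profile (`decide +kernel`). -/
theorem card_framedUnshared_five :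
    ((univ.filter fun σ : Equiv.Perm (Fin 5) => ∀ σ' : Equiv.Perm (Fin 5),
      (univ.val.map fun b : Fin 5 => (σ' b : ℤ) - b) = (univ.val.map fun b : Fin 5 => (σ b : ℤ) - b) → σ' = σ).filter fun σ : Equiv.Perm (Fin 5) =>
      ¬ (∀ a ∈ range 5, ∀ ℓ ∈ range 5, 1 ≤ ℓ → a + ℓ ≤ 5 →
        ∃ b : Fin 5, a ≤ (b : ℕ) ∧ (b : ℕ) < a + ℓ ∧ ¬ (a ≤ (σ b : ℕ) ∧ (σ b : ℕ) < a + ℓ))).card = 10 := by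
  decide +kernel

/-- members of an all-framed chain are framed with unshared profiles. -/
theorem image_subset_framedUnshared_five (ψ α : ℤ → ℤ) (P : ℤ → Prop) {N : ℕ} (θ' : Fin (N + 1) → ℤ)
    (τ : Fin (N + 1) → Equiv.Perm (Fin 5)) (hfr : ∀ k, ¬ Frameless (τ k)) (hτP : ∀ k b, P ((τ k b : ℤ) - b))
    (huniq : ∀ k (σ : Equiv.Perm (Fin 5)), σ ≠ τ k → (∀ b, P ((σ b : ℤ) - b)) →
      ∑ b, (θ' k * ψ ((σ b : ℤ) - b) + α ((σ b : ℤ) - b)) <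
        ∑ b, (θ' k * ψ ((τ k b : ℤ) - b) + α ((τ k b : ℤ) - b))) :
    univ.image τ ⊆ ((univ.filter fun σ : Equiv.Perm (Fin 5) => ∀ σ' : Equiv.Perm (Fin 5),
      (univ.val.map fun b : Fin 5 => (σ' b : ℤ) - b) = (univ.val.map fun b : Fin 5 => (σ b : ℤ) - b) → σ' = σ).filter fun σ : Equiv.Perm (Fin 5) =>
      ¬ (∀ a ∈ range 5, ∀ ℓ ∈ range 5, 1 ≤ ℓ → a + ℓ ≤ 5 →
        ∃ b : Fin 5, a ≤ (b : ℕ) ∧ (b : ℕ) < a + ℓ ∧ ¬ (a ≤ (σ b : ℕ) ∧ (σ b : ℕ) < a + ℓ))) := by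
  intro σ hσ
  obtain ⟨k, -, rfl⟩ := mem_image.mp hσ
  rw [mem_filter]
  exact ⟨image_subset_unshared ψ α P θ' τ hτP huniq hσ, fun h => hfr k ((frameless_iff_range (τ k)).mpr h)⟩

/-- **`Φ^fr_Toep(5) ≤ 9`**: ten framed unshared-profile permutations, among them the additive quadruple
`N(34201) + N(43210) = N(34210) + N(43201)`, so a chain misses one of them. -/
theorem framedInstanceBound_five : FramedInstanceBound 5 9 := by
  intro ψ α P N θ' τ hθ hinj hfr hτP huniq
  have hsub := image_subset_framedUnshared_five ψ α P θ' τ hfr hτP huniq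
  have hcard : (univ.image τ).card = N + 1 := by
    rw [card_image_of_injective _ hinj, card_univ, Fintype.card_fin]
  have h10 := card_le_card hsub
  rw [hcard, card_framedUnshared_five] at h10
  by_contra h9
  have heq : univ.image τ = _ := eq_of_subset_of_card_le hsub (by rw [card_framedUnshared_five, hcard]; omega)
  let s₁ : Equiv.Perm (Fin 5) := ⟨![3, 4, 2, 0, 1], ![3, 4, 2, 0, 1], by decide, by decide⟩
  let s₂ : Equiv.Perm (Fin 5) := ⟨![4, 3, 2, 1, 0], ![4, 3, 2, 1, 0], by decide, by decide⟩
  let s₃ : Equiv.Perm (Fin 5) := ⟨![3, 4, 2, 1, 0], ![4, 3, 2, 0, 1], by decide, by decide⟩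
  let s₄ : Equiv.Perm (Fin 5) := ⟨![4, 3, 2, 0, 1], ![3, 4, 2, 1, 0], by decide, by decide⟩
  have m₁ : s₁ ∈ univ.image τ := by rw [heq]; decide +kernel
  have m₂ : s₂ ∈ univ.image τ := by rw [heq]; decide +kernel
  have m₃ : s₃ ∈ univ.image τ := by rw [heq]; decide +kernel
  have m₄ : s₄ ∈ univ.image τ := by rw [heq]; decide +kernel
  obtain ⟨a, -, ha⟩ := mem_image.mp m₁
  obtain ⟨b, -, hb⟩ := mem_image.mp m₂
  obtain ⟨c, -, hc⟩ := mem_image.mp m₃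
  obtain ⟨d, -, hd⟩ := mem_image.mp m₄
  exact not_all_members_of_additive ψ α P θ' τ hθ hinj hτP huniq s₁ s₂ s₃ s₄ (by decide) (by decide) (by decide) (by decide)
    (by decide) ha hb hc hd

/-- **`Φ^fr_Toep(5) ≥ 8`: an explicit all-framed chain with `8` members.** [folklore] -/
theorem framed_five_chain_8 :
    ∃ (ψ α : ℤ → ℤ) (θ' : Fin 8 → ℤ) (τ : Fin 8 → Equiv.Perm (Fin 5)),
      StrictMono θ' ∧ Function.Injective τ ∧ (∀ k, ¬ Frameless (τ k)) ∧
      ∀ k (σ : Equiv.Perm (Fin 5)), σ ≠ τ k →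
        ∑ b, (θ' k * ψ ((σ b : ℤ) - b) + α ((σ b : ℤ) - b)) <
          ∑ b, (θ' k * ψ ((τ k b : ℤ) - b) + α ((τ k b : ℤ) - b)) := by
  -- instance: ψ = [40, 18, 14, 39, 14, 34, 29, 3, 32] , α = [8800, -3177, -6095, -20343, -2079, 974, 9045, -6806, 20810] on δ = -4..4; framed members ['34201', '01234', '41032', '43201', '41230', '43210', '42310', '43120'] at θ = [-1231, -832, -825, -737, -650, -473, 337, 4910]
  let ψᵢ : ℤ → ℤ := fun δ : ℤ => if δ = -4 then 40 else if δ = -3 then 18 else if δ = -2 then 14 else if δ = -1 then 39 else if δ = 0 then 14 else if δ = 1 then 34 else if δ = 2 then 29 else if δ = 3 then 3 else if δ = 4 then 32 else 0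
  let αᵢ : ℤ → ℤ := fun δ : ℤ => if δ = -4 then 8800 else if δ = -3 then -3177 else if δ = -2 then -6095 else if δ = -1 then -20343 else if δ = 0 then -2079 else if δ = 1 then 974 else if δ = 2 then 9045 else if δ = 3 then -6806 else if δ = 4 then 20810 else 0
  let τ0 : Equiv.Perm (Fin 5) := (⟨![3, 4, 2, 0, 1], ![3, 4, 2, 0, 1], by decide, by decide⟩ : Equiv.Perm (Fin 5))
  let τ1 : Equiv.Perm (Fin 5) := (⟨![0, 1, 2, 3, 4], ![0, 1, 2, 3, 4], by decide, by decide⟩ : Equiv.Perm (Fin 5))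
  let τ2 : Equiv.Perm (Fin 5) := (⟨![4, 1, 0, 3, 2], ![2, 1, 4, 3, 0], by decide, by decide⟩ : Equiv.Perm (Fin 5))
  let τ3 : Equiv.Perm (Fin 5) := (⟨![4, 3, 2, 0, 1], ![3, 4, 2, 1, 0], by decide, by decide⟩ : Equiv.Perm (Fin 5))
  let τ4 : Equiv.Perm (Fin 5) := (⟨![4, 1, 2, 3, 0], ![4, 1, 2, 3, 0], by decide, by decide⟩ : Equiv.Perm (Fin 5))
  let τ5 : Equiv.Perm (Fin 5) := (⟨![4, 3, 2, 1, 0], ![4, 3, 2, 1, 0], by decide, by decide⟩ : Equiv.Perm (Fin 5))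
  let τ6 : Equiv.Perm (Fin 5) := (⟨![4, 2, 3, 1, 0], ![4, 3, 1, 2, 0], by decide, by decide⟩ : Equiv.Perm (Fin 5))
  let τ7 : Equiv.Perm (Fin 5) := (⟨![4, 3, 1, 2, 0], ![4, 2, 3, 1, 0], by decide, by decide⟩ : Equiv.Perm (Fin 5))
  let θs : Fin 8 → ℤ := ![-1231, -832, -825, -737, -650, -473, 337, 4910]
  let τs : Fin 8 → Equiv.Perm (Fin 5) := ![τ0, τ1, τ2, τ3, τ4, τ5, τ6, τ7]
  have h0 : ∀ σ : Equiv.Perm (Fin 5), σ ≠ τ0 →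
      ∑ b, ((-1231 : ℤ) * ψᵢ ((σ b : ℤ) - b) + αᵢ ((σ b : ℤ) - b)) < ∑ b, ((-1231 : ℤ) * ψᵢ ((τ0 b : ℤ) - b) + αᵢ ((τ0 b : ℤ) - b)) := by
    decide +kernel
  have h1 : ∀ σ : Equiv.Perm (Fin 5), σ ≠ τ1 →
      ∑ b, ((-832 : ℤ) * ψᵢ ((σ b : ℤ) - b) + αᵢ ((σ b : ℤ) - b)) < ∑ b, ((-832 : ℤ) * ψᵢ ((τ1 b : ℤ) - b) + αᵢ ((τ1 b : ℤ) - b)) := by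
    decide +kernel
  have h2 : ∀ σ : Equiv.Perm (Fin 5), σ ≠ τ2 →
      ∑ b, ((-825 : ℤ) * ψᵢ ((σ b : ℤ) - b) + αᵢ ((σ b : ℤ) - b)) < ∑ b, ((-825 : ℤ) * ψᵢ ((τ2 b : ℤ) - b) + αᵢ ((τ2 b : ℤ) - b)) := by
    decide +kernel
  have h3 : ∀ σ : Equiv.Perm (Fin 5), σ ≠ τ3 →
      ∑ b, ((-737 : ℤ) * ψᵢ ((σ b : ℤ) - b) + αᵢ ((σ b : ℤ) - b)) < ∑ b, ((-737 : ℤ) * ψᵢ ((τ3 b : ℤ) - b) + αᵢ ((τ3 b : ℤ) - b)) := by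
    decide +kernel
  have h4 : ∀ σ : Equiv.Perm (Fin 5), σ ≠ τ4 →
      ∑ b, ((-650 : ℤ) * ψᵢ ((σ b : ℤ) - b) + αᵢ ((σ b : ℤ) - b)) < ∑ b, ((-650 : ℤ) * ψᵢ ((τ4 b : ℤ) - b) + αᵢ ((τ4 b : ℤ) - b)) := by
    decide +kernel
  have h5 : ∀ σ : Equiv.Perm (Fin 5), σ ≠ τ5 →
      ∑ b, ((-473 : ℤ) * ψᵢ ((σ b : ℤ) - b) + αᵢ ((σ b : ℤ) - b)) < ∑ b, ((-473 : ℤ) * ψᵢ ((τ5 b : ℤ) - b) + αᵢ ((τ5 b : ℤ) - b)) := by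
    decide +kernel
  have h6 : ∀ σ : Equiv.Perm (Fin 5), σ ≠ τ6 →
      ∑ b, ((337 : ℤ) * ψᵢ ((σ b : ℤ) - b) + αᵢ ((σ b : ℤ) - b)) < ∑ b, ((337 : ℤ) * ψᵢ ((τ6 b : ℤ) - b) + αᵢ ((τ6 b : ℤ) - b)) := by
    decide +kernel
  have h7 : ∀ σ : Equiv.Perm (Fin 5), σ ≠ τ7 →
      ∑ b, ((4910 : ℤ) * ψᵢ ((σ b : ℤ) - b) + αᵢ ((σ b : ℤ) - b)) < ∑ b, ((4910 : ℤ) * ψᵢ ((τ7 b : ℤ) - b) + αᵢ ((τ7 b : ℤ) - b)) := by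
    decide +kernel
  refine ⟨ψᵢ, αᵢ, θs, τs, Fin.strictMono_iff_lt_succ.mpr (by decide), by decide, fun k => ?_, fun k => ?_⟩
  · fin_cases k <;> exact fun hf => absurd ((frameless_iff_range _).mp hf) (by decide)
  · fin_cases k
    · exact h0
    · exact h1
    · exact h2
    · exact h3
    · exact h4
    · exact h5
    · exact h6
    · exact h7

/-- `Φ^fr_Toep(5) > 7`. -/
theorem not_framedInstanceBound_five_7 : ¬ FramedInstanceBound 5 7 := by
  intro h
  obtain ⟨ψ, α, θ', τ, hθ, hτ, hfr, hu⟩ := framed_five_chain_8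
  have := h ψ α (fun _ => True) 7 θ' τ hθ hτ hfr (fun _ _ => trivial) (fun k σ hσ _ => hu k σ hσ)
  omega

end Five

end Summit.ValiantsHypothesis.ValiantsHypothesis.Theorems.KPlusLogSqLaw.Toeplitz
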